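import Summits.QuantumFields.YangMills.Theorems.FlatTubeReductionGaussProfileDefs
import Summits.QuantumFields.YangMills.Theorems.FlatTubeReductionOrthoDensityFlatMap
import Summits.QuantumFields.YangMills.Theorems.LuscherReductionTwistedTraceScalingBOMassRatioHodge
import Summits.QuantumFields.YangMills.Theorems.LuscherReductionTwistedTraceScalingBTTubeMagnetic
import Summits.QuantumFields.YangMills.Theorems.LuscherReductionTwistedTraceScalingBOCentralTube
import Summits.QuantumFields.YangMills.Theorems.LuscherReductionTwistedTraceScalingBOSupportGeometry
import Summits.QuantumFields.YangMills.Theorems.LuscherReductionTwistedTraceScalingBOCapProfile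
import Summits.QuantumFields.YangMills.Theorems.LuscherReductionTwistedTraceScalingBOCurrencyFloor
import HarnessLib

/-!
# GAUSSIAN PROFILE NUMBERS I: the anisotropic quadratic level `balLevel` (homogeneity, `β‖x‖² ≤ N ≤ β²‖x‖²`), the two-sided GAUSSIAN SANDWICH of the record profile
# `e^{−50N}·𝟙 ≤ recordProfile β (linkEmbed v) ≤ e^{−c_L N}`, and the EXACT SCALING of the flat sublevel volumes `vol{N ≤ t} = (√t)^d·vol{N ≤ 1}` (polynomial volume growth)
# (route `FlatTubeReduction`, crux K1 `NearFlatRatioLaw` stmt-QuantumFields-24720; seat `ym-line-ftr-p1` g16; rate twin «ratepack-v5»; R2b1 RECORD rung — no summit statement is proved here)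

WHY (memo `Cruxes/NearFlatRatioLaw/Lines/ratepack-v5-nearpair-g16.md` §5–§6; NOTES `## PKG-R`).  With (E′)-lite (`…OrthoDensity.orthoTransverse_lintegral_two_sided`) the seven scalar
«profile numbers» of `…ExactDressingOfProfileNumbersSq.exactDressing_of_profileNumbers_sq` for the record profile at fibre radius `r_B` reduce to FLAT Gaussian facts, and those follow
from two ingredients proved here: (i) the profile is sandwiched between two Gaussians `e^{−κN}` of the SAME anisotropic level `N = balLevel β` (gauge width `β⁻¹`, stiff width `β^{-1/2}`;
upper bound from lane A's unconditional stiff coercivity `shell_exponent_ge`, lower bound from `stiffGaussExp_le_mul_norm_sq`), and (ii) the sublevel sets of `N` in the flat coordinates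
`w ↦ balExt L w` scale exactly, so `vol{N ≤ t} ≤ vol{N ≤ 1}·(t+1)^d` — the volume-growth hypothesis of the log-free layer-cake lemmas (`…GaussianLayerCake`) with a `β`-dependent
constant `v_β = vol{N ≤ 1}` that CANCELS in every profile number.
* §1 `norm_sq_eq_gauge_add_stiff`, `balLevel_nonneg/_smul/_zero`, `continuous_/measurable_balLevel`, ★ `mul_norm_sq_le_balLevel` (`β‖x‖² ≤ N`), `balLevel_le_sq_mul_norm_sq`;
* §2 `recordProfile_linkEmbed_of_not_mem/_eq`, `recordProfile_fields`, `recordProfile_support`, `norm_le_of_recordProfile_ne_zero`, `recordGamma_recordProfile_pos`,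
  ★★ `recordProfile_le_exp_neg` (`≤ e^{−c_L N}`, `c_L = min 1 ((2−2cos(2π/L))/2)`), ★★ `exp_neg_le_recordProfile` (`e^{−50N} ≤ ·` on the support ball at cap-balanced `v`);
* §3 `balLevel_balExt_smul`, ★ `sublevel_eq_smul`, ★ `volume_sublevel_eq`, `measurableSet_sublevel`, `sublevel_one_subset_closedBall`, `volume_sublevel_one_lt_top/_pos`,
  ★★ `volume_real_sublevel_le` (`vol{N ≤ t} ≤ v_β(t+1)^d`).
HONEST FRAMING: elementary (Mathlib + lane A's coercivity); the seven facts and the radius-`r_B` package are the next files; femto rung R2b1 (RECORD label); not infinite volume, not a gap,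
not Clay.  No defs, no named facts, no `sorry`.
-/

set_option autoImplicit false

noncomputable section

open MeasureTheory Filter Topology Real
open scoped BigOperators RealInnerProductSpace ENNReal Pointwise
open Literature.MathematicalPhysics.QuantumFieldTheory
open Literature.MathematicalPhysics.QuantumLattice

namespace Summit.QuantumFields.YangMills.Theorems.FemtoTransferGap.TwoLattice.ConstTube

open Summit.QuantumFields.YangMills.Theorems.FemtoTransferGap
open Summit.QuantumFields.YangMills.Theorems.FemtoTransferGap.TwoLattice.Stiff
open Summit.QuantumFields.YangMills.Theorems.FemtoTransferGap.TwoLattice.Toron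
open Summit.QuantumFields.YangMills.Theorems.FemtoTransferGap.TwoLattice.GnChart

variable (L : ℕ) [NeZero L]

/-! ## §1 The anisotropic quadratic level -/

/-- Pythagoras for the gauge projection: `‖x‖² = ‖P_Γx‖² + ‖x − P_Γx‖²`. [folklore] -/
theorem norm_sq_eq_gauge_add_stiff (x : LinkSpace L) :
    ‖x‖ ^ 2 = ‖(gaugeModes L).starProjection x‖ ^ 2 + ‖x - (gaugeModes L).starProjection x‖ ^ 2 := by
  rw [Submodule.norm_sq_eq_add_norm_sq_starProjection x (gaugeModes L), Submodule.starProjection_orthogonal_val]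

/-- `0 ≤ balLevel` for `β ≥ 0`. [folklore] -/
theorem balLevel_nonneg {β : ℝ} (hβ : 0 ≤ β) (v : Edge 3 L → Fin 3 → ℝ) : 0 ≤ balLevel L β v := by
  unfold balLevel; positivity

/-- The level is `2`-homogeneous: `balLevel (a•v) = a²·balLevel v`. [folklore] -/
theorem balLevel_smul (β a : ℝ) (v : Edge 3 L → Fin 3 → ℝ) : balLevel L β (a • v) = a ^ 2 * balLevel L β v := by
  unfold balLevel
  rw [LinearMap.map_smul, map_smul, ← smul_sub, norm_smul, norm_smul, Real.norm_eq_abs, mul_pow, mul_pow, sq_abs]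
  ring

/-- The level is continuous. [folklore] -/
theorem continuous_balLevel (β : ℝ) : Continuous (balLevel L β) := by
  have h1 : Continuous fun v : Edge 3 L → Fin 3 → ℝ => linkEmbed L v := (linkEmbed L).continuous_of_finiteDimensional
  have h2 : Continuous fun v : Edge 3 L → Fin 3 → ℝ => (gaugeModes L).starProjection (linkEmbed L v) := (gaugeModes L).starProjection.continuous.comp h1
  unfold balLevel
  exact (continuous_const.mul (h2.norm.pow 2)).add (continuous_const.mul ((h1.sub h2).norm.pow 2))

/-- The level is measurable. [folklore] -/
theorem measurable_balLevel (β : ℝ) : Measurable (balLevel L β) := (continuous_balLevel L β).measurable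

/-- ★ `β‖x‖² ≤ balLevel β v` for `β ≥ 1` (`x = linkEmbed L v`). [folklore] -/
theorem mul_norm_sq_le_balLevel {β : ℝ} (hβ : 1 ≤ β) (v : Edge 3 L → Fin 3 → ℝ) : β * ‖linkEmbed L v‖ ^ 2 ≤ balLevel L β v := by
  unfold balLevel
  rw [norm_sq_eq_gauge_add_stiff L (linkEmbed L v), mul_add]
  have h0 : 0 ≤ ‖(gaugeModes L).starProjection (linkEmbed L v)‖ ^ 2 := sq_nonneg _
  have hb : β ≤ β ^ 2 := by nlinarith
  nlinarith [mul_le_mul_of_nonneg_right hb h0]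

/-- `balLevel β v ≤ β²‖x‖²` for `β ≥ 1`. [folklore] -/
theorem balLevel_le_sq_mul_norm_sq {β : ℝ} (hβ : 1 ≤ β) (v : Edge 3 L → Fin 3 → ℝ) : balLevel L β v ≤ β ^ 2 * ‖linkEmbed L v‖ ^ 2 := by
  unfold balLevel
  rw [norm_sq_eq_gauge_add_stiff L (linkEmbed L v), mul_add]
  have h0 : 0 ≤ ‖linkEmbed L v - (gaugeModes L).starProjection (linkEmbed L v)‖ ^ 2 := sq_nonneg _
  have hb : β ≤ β ^ 2 := by nlinarith
  nlinarith [mul_le_mul_of_nonneg_right hb h0]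

/-- `balLevel β 0 = 0`. [folklore] -/
theorem balLevel_zero (β : ℝ) : balLevel L β 0 = 0 := by
  have h := balLevel_smul L β 0 0
  rw [zero_smul] at h
  simpa using h

/-! ## §2 The Gaussian sandwich of the record profile -/

/-- Off the cap-balanced set the record profile vanishes. [folklore] -/
theorem recordProfile_linkEmbed_of_not_mem (β : ℝ) {v : Edge 3 L → Fin 3 → ℝ} (hv : v ∉ capBalancedSet L) : recordProfile L β (linkEmbed L v) = 0 := by
  unfold recordProfile
  rw [Set.indicator_of_notMem (fun h => hv ((linkEmbed_mem_capLink_iff v).1 h)), zero_mul]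

/-- The record profile at a cap-balanced vector, unfolded (`β ≥ 1`, `powScale 1 β = β⁻¹`). [folklore] -/
theorem recordProfile_linkEmbed_eq {β : ℝ} (hβ : 1 ≤ β) {v : Edge 3 L → Fin 3 → ℝ} (hv : v ∈ capBalancedSet L) :
    recordProfile L β (linkEmbed L v) =
      Real.exp (-(β ^ 2 * ‖(gaugeModes L).starProjection (linkEmbed L v)‖ ^ 2)) * Real.exp (-(stiffGaussExp L (β / 2) β (linkEmbed L v))) *
        (Metric.closedBall (0 : LinkSpace L) (min (1 / 40) (powScale (1 / 2) β * btLog β))).indicator (fun _ => (1 : ℝ)) (linkEmbed L v) := by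
  unfold recordProfile frozenProfile
  have hβ0 : 0 < β := by linarith
  have hp : powScale 1 β = β⁻¹ := by rw [powScale_eq hβ, Real.rpow_neg hβ0.le, Real.rpow_one]
  rw [Set.indicator_of_mem ((linkEmbed_mem_capLink_iff v).2 hv), one_mul, hp, inv_pow, div_inv_eq_mul, mul_comm (‖_‖ ^ 2)]

/-- The basic fields of the record profile: measurable, `0 ≤ · ≤ 1` (`|·| ≤ 1`), colour-blind. [folklore] -/
theorem recordProfile_fields :
    (∀ β, Measurable (recordProfile L β)) ∧ (∀ β x, 0 ≤ recordProfile L β x ∧ recordProfile L β x ≤ 1) ∧ (∀ β x, |recordProfile L β x| ≤ 1) ∧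
      (∀ β (g : SU2) (x : LinkSpace L), recordProfile L β (adL L g x) = recordProfile L β x) := by
  obtain ⟨hm, h1, hinv, -, -⟩ := frozenProfile_fields (L := L) (q := fun β => stiffGaussExp L (β / 2) β) (fun β => measurable_stiffGaussExp (β / 2) β)
    (fun β x => stiffGaussExp_nonneg (β / 2) β x) (fun β g x => stiffGaussExp_adL (β / 2) β g x) (r := fun β => min (1 / 40) (powScale (1 / 2) β * btLog β))
    fun β => lt_min (by norm_num) (mul_pos (powScale_pos _ _) (lt_of_lt_of_le one_pos (one_le_btLog β)))
  have h0 : ∀ β x, 0 ≤ frozenProfile L (fun β => stiffGaussExp L (β / 2) β) (fun β => min (1 / 40) (powScale (1 / 2) β * btLog β)) β x := fun β x =>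
    (frozenProfile_mem_Icc (fun β x => stiffGaussExp_nonneg (β / 2) β x) _ β x).1
  refine ⟨fun β => measurable_capRestrict (hm β), fun β x => ?_, fun β x => (capRestrict_mem (h0 β) (h1 β) x).2.2, fun β g x => capRestrict_adL (hinv β) g x⟩
  obtain ⟨ha, hb, -⟩ := capRestrict_mem (h0 β) (h1 β) x
  exact ⟨ha, hb.trans (frozenProfile_mem_Icc (fun β x => stiffGaussExp_nonneg (β / 2) β x) _ β x).2⟩

/-- ★ The support of the record profile: `recordProfile β (linkEmbed v) ≠ 0 → v ∈ capBalancedSet ∧ (∀ e c, |v e c| ≤ r_B) ∧ ‖linkEmbed v‖ ≤ r_B`, `r_B = min (1/40) (powScale (1/2) β·btLog β)`.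
[folklore] -/
theorem recordProfile_support {β : ℝ} {v : Edge 3 L → Fin 3 → ℝ} (hv : recordProfile L β (linkEmbed L v) ≠ 0) :
    v ∈ capBalancedSet L ∧ (∀ (e : Edge 3 L) (c : Fin 3), |v e c| ≤ min (1 / 40) (powScale (1 / 2) β * btLog β)) ∧
      ‖linkEmbed L v‖ ≤ min (1 / 40) (powScale (1 / 2) β * btLog β) :=
  capRestrict_frozenProfile_support _ _ β v hv

/-- The support radius in `LinkSpace`: `recordProfile β x ≠ 0 → ‖x‖ ≤ r_B`. [folklore] -/
theorem norm_le_of_recordProfile_ne_zero {β : ℝ} {x : LinkSpace L} (hx : recordProfile L β x ≠ 0) : ‖x‖ ≤ min (1 / 40) (powScale (1 / 2) β * btLog β) :=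
  norm_le_of_frozenProfile_ne_zero _ _ β (right_ne_zero_of_mul hx)

/-- ★ The reference mass of the record profile is positive (lane A's `recordGamma_record_pos`). [folklore] -/
theorem recordGamma_recordProfile_pos {β : ℝ} (hβ : 0 ≤ β) : 0 < recordGamma L (recordProfile L) β := recordGamma_record_pos hβ

/-- ★★ **UPPER GAUSSIAN BOUND**: for every `v`, `β ≥ 1`, `L ≥ 2`: `recordProfile β (linkEmbed v) ≤ exp(−c_L·balLevel β v)`, `c_L = min 1 ((2 − 2cos(2π/L))/2) > 0` (lane A's
unconditional stiff coercivity `shell_exponent_ge` on balanced vectors; zero off the cap-balanced set). [cite: Luscher1983, §3] -/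
theorem recordProfile_le_exp_neg (hL : 2 ≤ L) {β : ℝ} (hβ : 1 ≤ β) (v : Edge 3 L → Fin 3 → ℝ) :
    recordProfile L β (linkEmbed L v) ≤ Real.exp (-(min 1 ((2 - 2 * Real.cos (2 * Real.pi / L)) / 2) * balLevel L β v)) := by
  by_cases hv : v ∈ capBalancedSet L
  swap
  · rw [recordProfile_linkEmbed_of_not_mem L β hv]; exact (Real.exp_pos _).le
  have hβ0 : 0 < β := by linarith
  set x := linkEmbed L v
  have hx : ∀ c ∈ constModes L, ⟪c, x⟫ = 0 := fun c hc => inner_constMode_linkEmbed_eq_zero hc hv.1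
  obtain ⟨hq, -⟩ := shell_exponent_ge hL (show (0 : ℝ) ≤ β / 2 by positivity) hβ0.le (b := β) hx
  rw [recordProfile_linkEmbed_eq L hβ hv]
  set c := min 1 ((2 - 2 * Real.cos (2 * Real.pi / L)) / 2) with hc
  have hc1 : c ≤ 1 := min_le_left _ _
  have hc2 : c ≤ (2 - 2 * Real.cos (2 * Real.pi / L)) / 2 := min_le_right _ _
  have hind : (Metric.closedBall (0 : LinkSpace L) (min (1 / 40) (powScale (1 / 2) β * btLog β))).indicator (fun _ => (1 : ℝ)) x ≤ 1 := by
    by_cases hm : x ∈ Metric.closedBall (0 : LinkSpace L) (min (1 / 40) (powScale (1 / 2) β * btLog β))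
    · rw [Set.indicator_of_mem hm]
    · rw [Set.indicator_of_notMem hm]; exact zero_le_one
  have hG : 0 ≤ ‖(gaugeModes L).starProjection x‖ ^ 2 := sq_nonneg _
  have hS : 0 ≤ ‖x - (gaugeModes L).starProjection x‖ ^ 2 := sq_nonneg _
  calc Real.exp (-(β ^ 2 * ‖(gaugeModes L).starProjection x‖ ^ 2)) * Real.exp (-(stiffGaussExp L (β / 2) β x)) *
        (Metric.closedBall (0 : LinkSpace L) (min (1 / 40) (powScale (1 / 2) β * btLog β))).indicator (fun _ => (1 : ℝ)) x
      ≤ Real.exp (-(β ^ 2 * ‖(gaugeModes L).starProjection x‖ ^ 2)) * Real.exp (-(stiffGaussExp L (β / 2) β x)) * 1 :=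
        mul_le_mul_of_nonneg_left hind (by positivity)
    _ = Real.exp (-(β ^ 2 * ‖(gaugeModes L).starProjection x‖ ^ 2 + stiffGaussExp L (β / 2) β x)) := by rw [mul_one, ← Real.exp_add]; ring_nf
    _ ≤ Real.exp (-(c * balLevel L β v)) := by
        refine Real.exp_le_exp.2 (neg_le_neg ?_)
        unfold balLevel
        have h2 : c * (β * ‖x - (gaugeModes L).starProjection x‖ ^ 2) ≤ stiffGaussExp L (β / 2) β x := by
          calc c * (β * ‖x - (gaugeModes L).starProjection x‖ ^ 2) ≤ (2 - 2 * Real.cos (2 * Real.pi / L)) / 2 * (β * ‖x - (gaugeModes L).starProjection x‖ ^ 2) :=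
                mul_le_mul_of_nonneg_right hc2 (by positivity)
            _ = β / 2 * (2 - 2 * Real.cos (2 * Real.pi / L)) * ‖x - (gaugeModes L).starProjection x‖ ^ 2 := by ring
            _ ≤ stiffGaussExp L (β / 2) β x := hq
        have h3 : c * (β ^ 2 * ‖(gaugeModes L).starProjection x‖ ^ 2) ≤ β ^ 2 * ‖(gaugeModes L).starProjection x‖ ^ 2 := by
          have : 0 ≤ β ^ 2 * ‖(gaugeModes L).starProjection x‖ ^ 2 := by positivity
          nlinarith
        rw [mul_add]; linarith

/-- ★★ **LOWER GAUSSIAN BOUND**: at a cap-balanced vector inside the support ball, `exp(−50·balLevel β v) ≤ recordProfile β (linkEmbed v)` for `β ≥ 1`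
(`q_{β/2,β}(x) ≤ 49β‖x‖²`, lane A's `stiffGaussExp_le_mul_norm_sq`). [folklore] -/
theorem exp_neg_le_recordProfile {β : ℝ} (hβ : 1 ≤ β) {v : Edge 3 L → Fin 3 → ℝ} (hv : v ∈ capBalancedSet L)
    (hr : ‖linkEmbed L v‖ ≤ min (1 / 40) (powScale (1 / 2) β * btLog β)) :
    Real.exp (-(50 * balLevel L β v)) ≤ recordProfile L β (linkEmbed L v) := by
  have hβ0 : 0 < β := by linarith
  set x := linkEmbed L v
  have hq : stiffGaussExp L (β / 2) β x ≤ (96 * (β / 2) + β) * ‖x‖ ^ 2 := stiffGaussExp_le_mul_norm_sq (by positivity) hβ0.le x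
  rw [recordProfile_linkEmbed_eq L hβ hv, Set.indicator_of_mem (Metric.mem_closedBall.2 (by rwa [dist_zero_right])), mul_one, ← Real.exp_add]
  refine Real.exp_le_exp.2 ?_
  have hN := mul_norm_sq_le_balLevel L hβ v
  have hdef : balLevel L β v = β ^ 2 * ‖(gaugeModes L).starProjection x‖ ^ 2 + β * ‖x - (gaugeModes L).starProjection x‖ ^ 2 := rfl
  have hS : 0 ≤ β * ‖x - (gaugeModes L).starProjection x‖ ^ 2 := by positivity
  nlinarith

/-! ## §3 Exact scaling of the sublevel volumes in the flat coordinates -/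

/-- The level in flat coordinates is `2`-homogeneous. [folklore] -/
theorem balLevel_balExt_smul (β a : ℝ) (w : {e : Edge 3 L // ¬e.1 = 0} → Fin 3 → ℝ) :
    balLevel L β (balExt L (a • w)) = a ^ 2 * balLevel L β (balExt L w) := by
  rw [map_smul, balLevel_smul]

/-- ★ **Sublevel sets scale**: `{w | N(w) ≤ t} = √t • {w | N(w) ≤ 1}` for `t > 0`. [folklore] -/
theorem sublevel_eq_smul (β : ℝ) {t : ℝ} (ht : 0 < t) :
    {w : {e : Edge 3 L // ¬e.1 = 0} → Fin 3 → ℝ | balLevel L β (balExt L w) ≤ t} = Real.sqrt t • {w : {e : Edge 3 L // ¬e.1 = 0} → Fin 3 → ℝ | balLevel L β (balExt L w) ≤ 1} := by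
  have hs : Real.sqrt t ≠ 0 := (Real.sqrt_pos.2 ht).ne'
  have hs2 : Real.sqrt t ^ 2 = t := Real.sq_sqrt ht.le
  ext w
  rw [Set.mem_smul_set_iff_inv_smul_mem₀ hs, Set.mem_setOf_eq, Set.mem_setOf_eq, balLevel_balExt_smul, inv_pow, hs2]
  rw [inv_mul_le_iff₀ ht, mul_one]

/-- ★ **The volume of a sublevel set**: `vol{N ≤ t} = (√t)^d · vol{N ≤ 1}` for `t > 0`, `d` the dimension of the flat coordinate space. [folklore] -/
theorem volume_sublevel_eq (β : ℝ) {t : ℝ} (ht : 0 < t) :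
    volume {w : {e : Edge 3 L // ¬e.1 = 0} → Fin 3 → ℝ | balLevel L β (balExt L w) ≤ t} =
      ENNReal.ofReal (Real.sqrt t ^ Module.finrank ℝ ({e : Edge 3 L // ¬e.1 = 0} → Fin 3 → ℝ)) *
        volume {w : {e : Edge 3 L // ¬e.1 = 0} → Fin 3 → ℝ | balLevel L β (balExt L w) ≤ 1} := by
  rw [sublevel_eq_smul L β ht, Measure.addHaar_smul, abs_of_nonneg (pow_nonneg (Real.sqrt_nonneg _) _)]

/-- The sublevel sets are measurable. [folklore] -/
theorem measurableSet_sublevel (β t : ℝ) : MeasurableSet {w : {e : Edge 3 L // ¬e.1 = 0} → Fin 3 → ℝ | balLevel L β (balExt L w) ≤ t} :=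
  measurableSet_le ((measurable_balLevel L β).comp (balExt L).continuous.measurable) measurable_const

/-- For `β ≥ 1` the unit sublevel set lies in the closed unit sup-ball (so it has finite volume). [folklore] -/
theorem sublevel_one_subset_closedBall {β : ℝ} (hβ : 1 ≤ β) :
    {w : {e : Edge 3 L // ¬e.1 = 0} → Fin 3 → ℝ | balLevel L β (balExt L w) ≤ 1} ⊆ Metric.closedBall 0 1 := by
  intro w hw
  rw [mem_closedBall_zero_iff]
  have hN := mul_norm_sq_le_balLevel L hβ (balExt L w)
  have h1 : ‖linkEmbed L (balExt L w)‖ ^ 2 ≤ 1 := by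
    have : ‖linkEmbed L (balExt L w)‖ ^ 2 ≤ β * ‖linkEmbed L (balExt L w)‖ ^ 2 := le_mul_of_one_le_left (sq_nonneg _) hβ
    exact this.trans (hN.trans hw)
  have h2 : ‖linkEmbed L (balExt L w)‖ ≤ 1 := by nlinarith [norm_nonneg (linkEmbed L (balExt L w))]
  refine (pi_norm_le_iff_of_nonneg zero_le_one).2 fun e' => ?_
  have h3 := norm_apply_le_norm_linkEmbed (balExt L w) e'.1
  have h4 : balExt L w e'.1 = w e' := funext fun a => by rw [balExt_apply, dif_neg e'.2]
  rw [h4] at h3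
  exact h3.trans h2

/-- ★ The unit sublevel volume `v_β = vol{N ≤ 1}` is finite … [folklore] -/
theorem volume_sublevel_one_lt_top {β : ℝ} (hβ : 1 ≤ β) : volume {w : {e : Edge 3 L // ¬e.1 = 0} → Fin 3 → ℝ | balLevel L β (balExt L w) ≤ 1} < ⊤ :=
  (measure_mono (sublevel_one_subset_closedBall L hβ)).trans_lt measure_closedBall_lt_top

/-- … and positive (it contains the open set `{N < 1} ∋ 0`). [folklore] -/
theorem volume_sublevel_one_pos (β : ℝ) : 0 < volume {w : {e : Edge 3 L // ¬e.1 = 0} → Fin 3 → ℝ | balLevel L β (balExt L w) ≤ 1} := by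
  have hopen : IsOpen {w : {e : Edge 3 L // ¬e.1 = 0} → Fin 3 → ℝ | balLevel L β (balExt L w) < 1} :=
    isOpen_lt ((continuous_balLevel L β).comp (balExt L).continuous) continuous_const
  have h0 : (0 : {e : Edge 3 L // ¬e.1 = 0} → Fin 3 → ℝ) ∈ {w : {e : Edge 3 L // ¬e.1 = 0} → Fin 3 → ℝ | balLevel L β (balExt L w) < 1} := by
    simp only [Set.mem_setOf_eq, map_zero, balLevel_zero]; exact one_pos
  have hsub : {w : {e : Edge 3 L // ¬e.1 = 0} → Fin 3 → ℝ | balLevel L β (balExt L w) < 1} ⊆ {w : {e : Edge 3 L // ¬e.1 = 0} → Fin 3 → ℝ | balLevel L β (balExt L w) ≤ 1} :=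
    fun w hw => le_of_lt (show balLevel L β (balExt L w) < 1 from hw)
  exact (hopen.measure_pos volume ⟨0, h0⟩).trans_le (measure_mono hsub)

/-- ★★ **POLYNOMIAL VOLUME GROWTH**: `vol{N ≤ t} ≤ vol{N ≤ 1}·(t+1)^d` for `t ≥ 0` — the hypothesis `hV` of the layer-cake lemmas (`…GaussianLayerCake`) with `V = vol{N ≤ 1}`, `m = d`.
[folklore] -/
theorem volume_real_sublevel_le {β : ℝ} (hβ : 1 ≤ β) {t : ℝ} (ht : 0 ≤ t) :
    (volume {w : {e : Edge 3 L // ¬e.1 = 0} → Fin 3 → ℝ | balLevel L β (balExt L w) ≤ t}).toReal ≤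
      (volume {w : {e : Edge 3 L // ¬e.1 = 0} → Fin 3 → ℝ | balLevel L β (balExt L w) ≤ 1}).toReal * (t + 1) ^ Module.finrank ℝ ({e : Edge 3 L // ¬e.1 = 0} → Fin 3 → ℝ) := by
  set d := Module.finrank ℝ ({e : Edge 3 L // ¬e.1 = 0} → Fin 3 → ℝ)
  have ht1 : 0 < t + 1 := by linarith
  have hmono : volume {w : {e : Edge 3 L // ¬e.1 = 0} → Fin 3 → ℝ | balLevel L β (balExt L w) ≤ t} ≤
      volume {w : {e : Edge 3 L // ¬e.1 = 0} → Fin 3 → ℝ | balLevel L β (balExt L w) ≤ t + 1} := measure_mono fun w (hw : _ ≤ t) => hw.trans (by linarith)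
  rw [volume_sublevel_eq L β ht1] at hmono
  have hfin := volume_sublevel_one_lt_top L hβ
  have hs : Real.sqrt (t + 1) ^ d ≤ (t + 1) ^ d := by
    refine pow_le_pow_left₀ (Real.sqrt_nonneg _) ?_ d
    rw [Real.sqrt_le_left ht1.le]; nlinarith
  calc (volume {w : {e : Edge 3 L // ¬e.1 = 0} → Fin 3 → ℝ | balLevel L β (balExt L w) ≤ t}).toReal
      ≤ (ENNReal.ofReal (Real.sqrt (t + 1) ^ d) * volume {w : {e : Edge 3 L // ¬e.1 = 0} → Fin 3 → ℝ | balLevel L β (balExt L w) ≤ 1}).toReal :=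
        ENNReal.toReal_mono (ENNReal.mul_ne_top ENNReal.ofReal_ne_top hfin.ne) hmono
    _ = Real.sqrt (t + 1) ^ d * (volume {w : {e : Edge 3 L // ¬e.1 = 0} → Fin 3 → ℝ | balLevel L β (balExt L w) ≤ 1}).toReal := by
        rw [ENNReal.toReal_mul, ENNReal.toReal_ofReal (by positivity)]
    _ ≤ (t + 1) ^ d * (volume {w : {e : Edge 3 L // ¬e.1 = 0} → Fin 3 → ℝ | balLevel L β (balExt L w) ≤ 1}).toReal := mul_le_mul_of_nonneg_right hs ENNReal.toReal_nonneg
    _ = _ := mul_comm _ _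

end Summit.QuantumFields.YangMills.Theorems.FemtoTransferGap.TwoLattice.ConstTube

end
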